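import Summits.BirchSwinnertonDyer.Rank1Residual.Supersingular.SharpFlatConverseReal
import Summits.BirchSwinnertonDyer.Rank1Residual.Supersingular.SignedSqueezeX7
import Literature.NumberTheory.EllipticCurves.Rank1Residual.Typed.X8
import Literature.NumberTheory.EllipticCurves.Sprung2012.SharpFlatSelmerDualExistsProofs
import Literature.NumberTheory.EllipticCurves.Sprung2012.SharpFlatKatoDivisibility
import Literature.NumberTheory.EllipticCurves.Sprung2012.ColemanMapTheorems
import Literature.NumberTheory.EllipticCurves.Sprung2017.SharpFlatNonvanishingProofs
import Literature.NumberTheory.EllipticCurves.Sprung2017.SharpFlatPAdicLFunctionProofs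
import Literature.NumberTheory.EllipticCurves.Sprung2024.ChromaticCharValueRankZeroAllN
import Literature.NumberTheory.EllipticCurves.CyclotomicZpExtensionLocalGeneratorProofs
import Literature.NumberTheory.EllipticCurves.KatoRankBoundProofs
import Literature.NumberTheory.EllipticCurves.Wuthrich2014.ThreeAdicImageSupersingularProofs
import Literature.NumberTheory.EllipticCurves.CuspFormLFunction
import Literature.NumberTheory.NumberFields.CongruenceSubgroupTorsionFree
import HarnessLib

/-!
# X8 (`p = 3` good supersingular, `a₃ = ±3`) ∩ {`ρ̄_{E,3}` onto}, analytic rank `0`: the UPPER half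
# `ord₃ #Ш ≤ ord₃ #Ш_an` IN THE KERNEL from Kato's divisibility through Sprung's ♯/♭ Coleman maps
# (Sprung 2012 Thm. 7.16) + the ♯/♭ control / Euler characteristic (Sprung 2024 §5.2) — i.e.
# Sprung 2024 Cor. 1.2 (second sentence) DERIVED from its printed ingredients, by name
# (cell `bsd-print-x8`, D-0131 (2) print tier, prover seat p2; route-independent file)

PARTITION (cell bsd-print-x8, leaf `ClassX8`, K3 row A8): X8 ∩ {surj(3)} ∩ {r_an = 0} — 82 of the
217 census cells (`A8_x8_open_cells.v3.tsv`); per-pair and class theorems CONDITIONAL on published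
named facts; closes NONE; 0 census moves; BSD is not proved by any of this.

HONEST FRAMING. Seat p2's strategy sentence begins «♯♭ ⊇-half from Kato via Sprung's ♯♭ Coleman
maps + ♯♭ control ⇒ r0 upper bound». In the tree that upper bound is available BY NAME twice over —
Perrin-Riou 2003 Prop. 4.8 (`PerrinRiou2003.prop48_…`, flag `PR03-Prop4.8-Kato-attribution`) and
Sprung 2024 Cor. 1.2 (ii) (`Sprung2024.cor12_…`, square-free `N`, flag `Sprung24-Cor12ii-via-Spr12-7.16`)
— both as statement-only facts. THIS file DERIVES it on class X8 ∩ {surj(3)} from the ♯/♭-internal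
named facts the K3 / print routes already carry, so that the referee prices ONE chain:
* Sprung 2012 Thm. 2.2 (`thm22_exists_isHondaSystem`, Honda systems), Thm. 7.14
  (`thm714_sharpFlatSelmerDual_finite_torsion`, `X^•` is `Λ`-torsion), **Thm. 7.16**
  (`thm716_sharpFlatCharIdeal_divisibility`: Kato's zeta element through the ♯/♭ Coleman maps gives
  `gen ∣ L^•`, with `n = 0` under `GL₂(ℤ₃)`-surjectivity — flag `Sp12-716-period`);
* Sprung 2024 §5.2 Lemmas 5.5–5.9 at all levels (`Sprung2024.lem59AllN_sharpFlatCharValue_rankZero`,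
  the ♯/♭ CONTROL / Euler characteristic `gen(0) ∼ #Sel_{3^∞}(E/ℚ)·∏c_ℓ`; flag
  `Sprung24-§5.2-allN-via-RaySprung25`; control Lemma 5.6 is a kernel theorem);
* the period unit at `3` (`realPeriodRat_eq_unit_mul_plusPeriod_three`), modularity
  (`ModularForms.exists_isNewformOf`, `hasEntireLFunction_rat`), GZK.
Everything else is a THEOREM of the tree: Sprung's pair exists (Sprung 2017 Thm. 1.12,
`thm112_exists_isSprungPair_holds`), one colour has `L^• ≠ 0` (Sprung 2012 Prop. 6.14,
`IsSprungPair.exists_chromaticL_ne_zero`), the interpolation (P•) `L^•(0) = c_•·[0]⁺_f` with `3 ∤ c_•`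
on X8 (`constantCoeff_chromaticL_of_isSprungPair_of_isNewformOf`, `ClassX8.not_dvd_chromaticConst'`),
the real dual `X^•` (`Sprung2012.sharpFlatSelmerDualData`), `char_Λ` principal (`Λ` a UFD), and the
`3`-adic surjectivity from `surj(3)` at the good supersingular `3` (Wuthrich 2014 Lemma 20, kernel:
`Wuthrich2014.lemma20_surjective_threeAdic_of_semistable_holds`).

* `missingUpperBoundAt_of_chromaticUpperDivisibility` — the ABSTRACT one-sided chain with the REAL
  `L^•` (twin of b2b's `missingLowerBoundAt_of_chromaticLowerDivisibility`): `ξ` with (K•) and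
  `ξ ∣ L^•` ⇒ `MissingUpperBoundAt W p` (unit-normalise by `exists_units_interpolation_chromaticL`,
  then `missingUpperBoundAt_of_signedUpperDivisibility`).
* `X8.missingUpperBoundAt_of_sharpFlatKato_of_surj_of_analyticRank_eq_zero` — **X8 ∧ surj(3) ∧
  `r_an = 0`: `ord₃ #Ш ≤ ord₃ #Ш_an` from the eight named facts above** (NO Perrin-Riou / Wuthrich
  Prop. 21 / Sprung 2024 Cor. 1.2 binder) — p2's clause 1 in the kernel; `_of_semistable_` drops the
  image datum (Serre Props. 12 + 21 i)) = Sprung 2024 Cor. 1.2 (ii) restricted to `a₃ = ±3`, DERIVED.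
* `X8.upperHalf_rankZero_surj_of_sharpFlatFacts` — class form (82 cells); hence the unit-cell and
  lower-half-only closers of `WAll/CornerX8Print.lean` on this branch in rank `0` can be fed these
  facts instead of `hPR` (`X8.bsdp_of_missingLowerBoundAt_of_sharpFlatFacts_of_surj`).
Beyond-print theorem: NO (derivation from printed, typed ingredients). The rank-ONE upper half has no
such ♯/♭-internal derivation in the tree (no `p`-adic height objects): there the binder of record
stays Kobayashi 2013 ∘ Perrin-Riou 2003 Prop. 4.20 (`Kobayashi2013.rem13_…`).

References: [Sprung2012] Thm. 2.2, Prop. 6.14, Thm. 7.14, Thm. 7.16 (pp. 1487, 1498, 1504);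
[Sprung2024] Cor. 1.2 (p. 4), §5.2 Lemmas 5.5–5.9 (pp. 40–41); [Sprung2017] Thm. 1.12, Cor. 4.11;
[Wuthrich2014] Lemma 20 (p. 399); [Mazur1978] Cor. 4.1; [GreenbergVatsal2000] §3 Rem. 3.4;
[Washington1997] §13.2; [Miller2011LMS] Def. 1.1.
-/

set_option autoImplicit false

noncomputable section

open scoped Classical NumberField MatrixGroups ModularForm
open NumberField IsDedekindDomain WeierstrassCurve CongruenceSubgroup
  Literature.NumberTheory.EllipticCurves Literature.NumberTheory.EllipticCurves.ModularForms
  Literature.NumberTheory.EllipticCurves.Rank1Residual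
  Literature.NumberTheory.EllipticCurves.Rank1Residual.Typed
  Literature.NumberTheory.EllipticCurves.Sprung2017 Literature.NumberTheory.EllipticCurves.Sprung2012
  Literature.NumberTheory.EllipticCurves.Sprung2024
  Literature.NumberTheory.EllipticCurves.ZpExtension

namespace Summit.BirchSwinnertonDyer.Rank1Residual.Supersingular

section Chain

variable (W : WeierstrassCurve ℚ) [W.IsElliptic] [W.IsGloballyMinimal] (p : ℕ) [Fact p.Prime]

/-- **The ♯/♭ rank-zero chain, UPPER half, with Sprung's real `L^•`.** `p` odd of good reduction,
`E[p]` irreducible, `L(E,1) ≠ 0`, `f` the newform of `W` with `Ω_E = u·Ω⁺_f`, `|u|_p = 1`, `(L♯, L♭)`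
any Sprung pair, `•` a colour with `p ∤ c_•`; displayed: `ξ ∈ Λ` with (K•) (a characteristic power
series of `X^•(E/ℚ_∞)`) and the Kato-side divisibility `ξ ∣ L^•` (Sprung 2012 Thm. 7.16, `n = 0`).
CONCLUSION `ord_p #Ш ≤ ord_p #Ш_an`. Chain: unit-normalise `L^•` to a `c = 1` datum
(`exists_units_interpolation_chromaticL`), then `missingUpperBoundAt_of_signedUpperDivisibility`.
[cite: Sprung2012, Thm. 7.16 (p. 1504)] [cite: Sprung2017, Cor. 4.11] [cite: Miller2011LMS, Def. 1.1] -/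
theorem missingUpperBoundAt_of_chromaticUpperDivisibility
    (hGZK : rank_eq_analyticRank_of_analyticRank_le_one)
    (hp : p ≠ 2) (hgood : W.HasGoodReductionAtPrime p)
    (hirr : W.HasIrreducibleModPGaloisRep p) (hL : W.entireLFunction 1 ≠ 0)
    {N : ℕ} [NeZero N] {f : CuspForm (Gamma0 N) 2} (hf : IsNewformOf W f)
    (hΩ : ∃ u : ℚ, ‖(u : ℚ_[p])‖ = 1 ∧ W.realPeriodRat = u * plusPeriod f)
    {Lsharp Lflat : IwasawaAlgebra p} (hSP : IsSprungPair f p (W.frobeniusTrace p) Lsharp Lflat)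
    (c : Chroma) (hc : ¬ (p : ℤ) ∣ chromaticConst p (W.frobeniusTrace p) c)
    (ξ : IwasawaAlgebra p) (hK : (⟨ξ, 0, 0⟩ : SignedDatum W p).EulerCharacteristic)
    (hU : ξ ∣ chromaticL c Lsharp Lflat) : MissingUpperBoundAt W p := by
  have hpP : p.Prime := Fact.out
  obtain ⟨w, hP⟩ := exists_units_interpolation_chromaticL W p hp hgood hf hΩ hSP c hc ξ
  exact missingUpperBoundAt_of_signedUpperDivisibility W p hGZK hirr hL
    (⟨ξ, PowerSeries.C ((w : ℤ_[p]ˣ) : ℤ_[p]) * chromaticL c Lsharp Lflat, 1⟩ : SignedDatum W p)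
    hpP.not_dvd_one hK hP (dvd_mul_of_dvd_right hU _)

end Chain

/-! ### X8 ∧ surj(3) ∧ `r_an = 0`: the upper half from the ♯/♭ named facts (Sprung 2024 Cor. 1.2 (ii),
derived) -/

section X8

/-- **X8 ∧ surj(3) ∧ `r_an = 0`: `ord₃ #Ш ≤ ord₃ #Ш_an` from Kato through the ♯/♭ Coleman maps + the
♯/♭ control.** Named inputs (published): modularity `exists_isNewformOf` (`hmodf`), Sprung 2012 Thm.
2.2 (`h22`), Thm. 7.14 (`h714`), Thm. 7.16 (`h716`, Kato), Sprung 2024 §5.2 (`h59`), the period unit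
at `3` (`h3`), GZK (`hGZK`), entire continuation (`hmod`). Kernel theorems supply the pair (Sprung 2017
Thm. 1.12), an admissible colour (Prop. 6.14), the cyclotomic setting and local lift, the real `X^•`,
a generator of `char_Λ X^•`, and the `3`-adic surjectivity from `surj(3)` (Wuthrich 2014 Lemma 20).
PER PAIR; conditional on the named facts; closes nothing.
[cite: Sprung2012, Thm. 2.2, Prop. 6.14, Thm. 7.14 and Thm. 7.16] [cite: Sprung2024, Cor. 1.2 (p. 4) and §5.2 Lemmas 5.5–5.9]
[cite: Wuthrich2014, Lemma 20 (p. 399)] [cite: Miller2011LMS, Def. 1.1] -/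
theorem X8.missingUpperBoundAt_of_sharpFlatKato_of_surj_of_analyticRank_eq_zero
    (hmodf : exists_isNewformOf) (h22 : thm22_exists_isHondaSystem)
    (h714 : thm714_sharpFlatSelmerDual_finite_torsion)
    (h716 : thm716_sharpFlatCharIdeal_divisibility)
    (h59 : lem59AllN_sharpFlatCharValue_rankZero)
    (h3 : realPeriodRat_eq_unit_mul_plusPeriod_three)
    (hGZK : rank_eq_analyticRank_of_analyticRank_le_one) (hmod : hasEntireLFunction_rat)
    (W : WeierstrassCurve ℚ) [W.IsElliptic] [W.IsGloballyMinimal] (p : ℕ) [Fact p.Prime]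
    (hX : ClassX8 W p) (hs : Surj W p) (h0 : W.analyticRank = 0) : MissingUpperBoundAt W p := by
  have hp3 : p = 3 := hX.1
  subst hp3
  have hp2 : (3 : ℕ) ≠ 2 := by decide
  have hgood : W.HasGoodReductionAtPrime 3 := hX.2.1.1
  have hdvd : ((3 : ℕ) : ℤ) ∣ W.frobeniusTrace 3 := hX.2.1.2
  have hirr : W.HasIrreducibleModPGaloisRep 3 := ClassX8.irr W 3 hX
  have hL : W.entireLFunction 1 ≠ 0 := (W.analyticRank_eq_zero_iff_holds (hmod W)).1 h0
  -- the newform (modularity), Sprung's pair (Sprung 2017 Thm. 1.12), an admissible colour (Prop. 6.14)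
  haveI : NeZero (W.conductorNorm ℤ) := ⟨(W.conductorNorm_pos_holds).ne'⟩
  obtain ⟨f, hf⟩ := hmodf W
  obtain ⟨Lsharp, Lflat, hSP⟩ :=
    thm112_exists_isSprungPair_holds (W := W) (f := f) (p := 3) hp2 hf hgood hdvd
  obtain ⟨col, hcol⟩ := hSP.exists_chromaticL_ne_zero hf hgood
  -- the cyclotomic setting, the place above `3`, the local lift, a Honda system (Thm. 2.2)
  obtain ⟨κ, hκ, γ, hγ, hγ'⟩ := exists_isCyclotomic_isTopGenerator_isCyclotomicVariable_holds 3
  obtain ⟨v, hv⟩ :=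
    Literature.NumberTheory.NumberFields.RingOfIntegers.exists_heightOneSpectrum_natCast_mem ℚ
      (p := 3) (by norm_num)
  obtain ⟨g, hg⟩ := hκ.exists_isTopGenerator_resGalOfEmb_adicCompletion v hv
  obtain ⟨cneg, c, hc⟩ := h22 W 3 hp2 hgood hdvd κ γ hκ hγ hγ' v hv g hg
  -- the REAL `X^•`, a generator of its characteristic ideal, torsion (Thm. 7.14)
  let D := sharpFlatSelmerDualData W κ (closureEmb (K := ℚ) (v.adicCompletion ℚ))
    (W.frobeniusTrace 3) g c col hγ
  obtain ⟨hfinD, htorD⟩ :=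
    h714 W 3 hp2 hgood hdvd f hf κ γ hκ hγ hγ' v hv g hg cneg c hc col Lsharp Lflat hSP hcol D
  haveI := hfinD
  obtain ⟨gen, hgen⟩ := (charIdeal_isPrincipal_holds 3 D.X).principal
  have hchar : D.charIdeal = Ideal.span {gen} := hgen
  -- (K•): the ♯/♭ control / Euler characteristic (Sprung 2024 Lemmas 5.5–5.9, all levels)
  have hK : (⟨gen, 0, 0⟩ : SignedDatum W 3).EulerCharacteristic := fun hfin =>
    h59 W 3 hp2 hgood hdvd hL κ γ hκ hγ hγ' v hv g hg cneg c hc col D htorD gen hchar hfin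
  -- Kato through the ♯/♭ Coleman maps (Sprung 2012 Thm. 7.16), integral by `3`-adic surjectivity
  have hsurj : ∀ n : ℕ, W.HasSurjectiveModNGaloisRep (3 ^ n : ℕ) :=
    surjective_pow_of_surj_of_good W 3 Wuthrich2014.lemma20_surjective_threeAdic_of_semistable_holds
      hp2 hgood hs
  have hKato : gen ∣ chromaticL col Lsharp Lflat :=
    h716.dvd_of_charIdeal_eq_span hp2 hgood hdvd hf hκ hγ hγ' hv hg hc hSP hcol D htorD hsurj hchar
  exact missingUpperBoundAt_of_chromaticUpperDivisibility W 3 hGZK hp2 hgood hirr hL hf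
    (h3 W hgood hirr f hf) hSP col (ClassX8.not_dvd_chromaticConst' W 3 hX col) gen hK hKato

/-- **X8 ∩ {sst} ∧ `r_an = 0`: the upper half from the ♯/♭ named facts, NO image datum** (`surj(3)`
automatic for semistable X8 curves, `ClassX8.surj_of_semistable`) — Sprung, Adv. Math. 449 (2024)
Cor. 1.2, second sentence, at `a₃ = ±3`, DERIVED in the kernel from its printed ingredients.
[cite: Sprung2024, Cor. 1.2 (p. 4), second sentence] [cite: Serre1972, §5.4 Prop. 21 i)]
[cite: Sprung2012, Thm. 2.2, Thm. 7.14 and Thm. 7.16] -/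
theorem X8.missingUpperBoundAt_of_sharpFlatKato_of_semistable_of_analyticRank_eq_zero
    (hmodf : exists_isNewformOf) (h22 : thm22_exists_isHondaSystem)
    (h714 : thm714_sharpFlatSelmerDual_finite_torsion)
    (h716 : thm716_sharpFlatCharIdeal_divisibility)
    (h59 : lem59AllN_sharpFlatCharValue_rankZero)
    (h3 : realPeriodRat_eq_unit_mul_plusPeriod_three)
    (hGZK : rank_eq_analyticRank_of_analyticRank_le_one) (hmod : hasEntireLFunction_rat)
    (W : WeierstrassCurve ℚ) [W.IsElliptic] [W.IsGloballyMinimal] (p : ℕ) [Fact p.Prime]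
    (hX : ClassX8 W p) (hsst : Semistable W) (h0 : W.analyticRank = 0) :
    MissingUpperBoundAt W p := by
  have hs : Surj W p := by
    have hp3 : p = 3 := hX.1
    subst hp3
    exact ClassX8.surj_of_semistable W 3 hX hsst
  exact X8.missingUpperBoundAt_of_sharpFlatKato_of_surj_of_analyticRank_eq_zero hmodf h22 h714 h716
    h59 h3 hGZK hmod W p hX hs h0

/-- **X8 ∧ surj(3) ∧ `r_an = 0`: `BSD(E,3)` from the lower half alone, the upper half from the ♯/♭
named facts** (twin of `X8.bsdp_of_missingLowerBoundAt_of_prop48_of_surj` /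
`X8.bsdp_of_missingLowerBoundAt_of_surj` with `hPR` / `hW` replaced by the Sprung-side facts).
[cite: Sprung2012, Thm. 7.16 (p. 1504)] [cite: Sprung2024, §5.2 Lemmas 5.5–5.9] [cite: Miller2011LMS, §1 and Def. 1.1] -/
theorem X8.bsdp_of_missingLowerBoundAt_of_sharpFlatFacts_of_surj
    (hmodf : exists_isNewformOf) (h22 : thm22_exists_isHondaSystem)
    (h714 : thm714_sharpFlatSelmerDual_finite_torsion)
    (h716 : thm716_sharpFlatCharIdeal_divisibility)
    (h59 : lem59AllN_sharpFlatCharValue_rankZero)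
    (h3 : realPeriodRat_eq_unit_mul_plusPeriod_three)
    (hGZK : rank_eq_analyticRank_of_analyticRank_le_one) (hmod : hasEntireLFunction_rat)
    (W : WeierstrassCurve ℚ) [W.IsElliptic] [W.IsGloballyMinimal] (p : ℕ) [Fact p.Prime]
    (hX : ClassX8 W p) (hs : Surj W p) (h0 : W.analyticRank = 0)
    (hlow : MissingLowerBoundAt W p) : BSDp W p :=
  bsdp_of_missingPPartAt W p hGZK (by omega)
    (missingPPartAt_of_lower_of_upper W p hlow
      (X8.missingUpperBoundAt_of_sharpFlatKato_of_surj_of_analyticRank_eq_zero hmodf h22 h714 h716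
        h59 h3 hGZK hmod W p hX hs h0))

/-- **UNIT CELLS, X8 ∧ surj(3) ∧ `r_an = 0`, ♯/♭-internal binders**: `ord₃ #Ш_an ≤ 0` ⇒ `BSD(E,3)`.
[cite: Sprung2012, Thm. 7.16 (p. 1504)] [cite: Sprung2024, §5.2 Lemmas 5.5–5.9] [cite: Miller2011LMS, §1 and Def. 1.1] -/
theorem X8.bsdp_of_shaAn_le_of_sharpFlatFacts_of_surj_of_analyticRank_eq_zero
    (hmodf : exists_isNewformOf) (h22 : thm22_exists_isHondaSystem)
    (h714 : thm714_sharpFlatSelmerDual_finite_torsion)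
    (h716 : thm716_sharpFlatCharIdeal_divisibility)
    (h59 : lem59AllN_sharpFlatCharValue_rankZero)
    (h3 : realPeriodRat_eq_unit_mul_plusPeriod_three)
    (hGZK : rank_eq_analyticRank_of_analyticRank_le_one) (hmod : hasEntireLFunction_rat)
    (W : WeierstrassCurve ℚ) [W.IsElliptic] [W.IsGloballyMinimal] (p : ℕ) [Fact p.Prime]
    (hX : ClassX8 W p) (hs : Surj W p) (h0 : W.analyticRank = 0)
    (hsha : ∃ q : ℚ, shaAn W = (q : ℂ) ∧ padicValRat p q ≤ 0) : BSDp W p := by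
  refine X8.bsdp_of_missingLowerBoundAt_of_sharpFlatFacts_of_surj hmodf h22 h714 h716 h59 h3 hGZK hmod
    W p hX hs h0 ?_
  obtain ⟨q, hq, hle⟩ := hsha
  exact ⟨q, hq, hle.trans (by exact_mod_cast Nat.zero_le _)⟩

/-- **CLASS form: the upper half on all of X8 ∩ {surj(3)} ∩ {r_an = 0}** (82 census cells) from the
eight ♯/♭-side named facts — the p2 sentence's clause 1 «♯♭ ⊇-half from Kato via Sprung's ♯♭ Coleman
maps + ♯♭ control ⇒ r0 upper bound» as a kernel theorem; on this class it makes the Perrin-Riou 2003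
Prop. 4.8 / Sprung 2024 Cor. 1.2 (ii) binders redundant. [cite: Sprung2012, Thm. 2.2, Thm. 7.14 and Thm. 7.16]
[cite: Sprung2024, Cor. 1.2 (p. 4) and §5.2 Lemmas 5.5–5.9] [cite: Wuthrich2014, Lemma 20 (p. 399)] -/
theorem X8.upperHalf_rankZero_surj_of_sharpFlatFacts
    (hmodf : exists_isNewformOf) (h22 : thm22_exists_isHondaSystem)
    (h714 : thm714_sharpFlatSelmerDual_finite_torsion)
    (h716 : thm716_sharpFlatCharIdeal_divisibility)
    (h59 : lem59AllN_sharpFlatCharValue_rankZero)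
    (h3 : realPeriodRat_eq_unit_mul_plusPeriod_three)
    (hGZK : rank_eq_analyticRank_of_analyticRank_le_one) (hmod : hasEntireLFunction_rat) :
    ∀ (W : WeierstrassCurve ℚ) [W.IsElliptic] [W.IsGloballyMinimal] (p : ℕ) [Fact p.Prime],
      ClassX8 W p → Surj W p → W.analyticRank = 0 → MissingUpperBoundAt W p :=
  fun W _ _ p _ hX hs h0 ↦
    X8.missingUpperBoundAt_of_sharpFlatKato_of_surj_of_analyticRank_eq_zero hmodf h22 h714 h716 h59 h3
      hGZK hmod W p hX hs h0

end X8

end Summit.BirchSwinnertonDyer.Rank1Residual.Supersingular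

end
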